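import Summits.ABC.IUTFork.Joshi.TestVolumeMatch
import Summits.ABC.IUTFork.Joshi.TestVolumeCharacterDichotomy
import Summits.ABC.IUTFork.Joshi.TestFundamentalEstimateHonestModel
import HarnessLib

/-!
# Branch E, X-07‴ (VOLUME MATCH) — supplement: per-element dichotomy, volume characters, the Y₁-form, and Joshi's frame
# (second adversary seat abc-iut-E-cx-2; sequel to `Joshi/TestVolumeMatch.lean` p432720)

AUTHORED BY abc-iut-E-cx-2 (refuter seat refuter-abc-iut-E-cx-2-g0-0); proxy-filed VERBATIM by a prover hand (cell PROXY RULE, plan/repair/REPAIR-SPEC.md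
§2). Record file of the abc-iut cell, branch E «type Joshi's construction, test vs S» (rung LADDER-ABC:A2.E). **No side is taken** on
[IUTchIII] Cor. 3.12, on Joshi's claims (unrefereed arXiv preprints) or on Mochizuki's report on them; typed ≠ proved ≠ endorsed. PROOF-ONLY over
`Joshi/TestVolumeMatch.lean` (p432720), `Joshi/TestVolumeCharacterDichotomy.lean` (abc-iut-E-t43, p431585),
`Joshi/TestFundamentalEstimateHonestModel.lean` (abc-iut-E-t4, p429514), `Joshi/TestHarness.lean` (p428758): 0 new `def`, no `Prop` fact, no
instance, no `sorry`. S := `Cor312Vol.PilotKummerIndRelated S P ρ qK`; «volume match at `(j, v_ℚ)`» := `∃ m, logvol (ρ qK j v_ℚ) = logvol (ρ Ψ^{(m)} j v_ℚ)`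
(inline, as in p432720).

## Content
* §1 PER-ELEMENT DICHOTOMY. p432720 §2 is stated under abc-iut-E-cx's X-07″ binder `H1` (TestHullOrVolume.lean), whose second horn asks the
  powers of `Φ` ITSELF to escape every hull-set; abc-iut-E-t43 observed (p431585, NOTE at `preserving_or_not_hullDefined_of_volumeCharacter`)
  that this per-`Φ` form FAILS for a uniformly contracting `Φ` (neither volume-preserving nor forward-escaping, although `Φ⁻¹` destroys the
  hull), and proved the satisfiable PER-ELEMENT form «`Φ` volume-preserving on admissible regions at the packet ∨ `¬HullDefined` there» from
  volume characters. Here: E-cx's binder implies the per-element form (`preserving_or_not_hullDefined_of_escapeDichotomy`); p432720's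
  packetwise theorem and its `¬Statement ∧ ¬BridgeHyps` consequence restated under the per-element form (primed names); and the binder
  DISCHARGED by E-t43's characters: generators with volume characters at the packet + packet-monotonicity of log-volume + admissible Θ-Kummer
  datum regions one of which lies in `Θ3` ⟹ (S ⟹ volume match ∨ `¬HullDefined` at that packet) — `exists_logvol_eq_or_not_hullDefined_of_character`,
  `not_statement_of_pilotKummerIndRelated_of_ne_of_character` (NO dichotomy binder left).
* §2 Y₁-FORM (the X-01 dictionary sentence): `UntiltChangeIsInd u ∧ UntiltChangeCarriesQ u` (p428758; [J-III] arXiv:2401.13508 §8.11.1 p.91 read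
  as (Ind2)) ⟹ per packet volume match ∨ `¬HullDefined`, NO Thm 3.11 clause / (hρ) / pins (`exists_logvol_eq_or_not_hullDefined_of_untiltChange`,
  `not_statement_of_untiltChange_of_ne`): the FILLS-MODULO-Y₁ programme delivers S only with volume match or where the Statement fails as typed.
* §3 JOSHI'S FRAME. p432720 placed the mismatch at `j = 2` in Mochizuki's normalisation (`pinnedSetting_logvol_ne`, `B_4` vs `B_1`). At
  abc-iut-E-t4's object-honest Joshi-normalised setting (p429514: q := `p^{ℓ*²}`, q-region `B_4` at every label of `𝔽_l^⋇`, Θ-Kummer datum regions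
  `B_{j²}`; the printed Statement HOLDS there, `honest_statement`) the mismatch is at `j = 1` (`B_1` vs `B_4`, Θ ABOVE q:
  `honestJoshiSetting_logvol_ne`) with match EXACTLY at the top label `j = ℓ* = 2` (`honestJoshiSetting_logvol_eq_top` — the one label where
  (9.9.4)'s exponent `j²/ℓ*²` is `1`); the dichotomy is discharged there (the sign group fixes every ball), so S is refuted at that
  Statement-satisfying setting BY THE VOLUME ROUTE (`honestJoshiSetting_not_pilotKummerIndRelated_by_volume`; E-t4's
  `honest_not_pilotKummerIndRelated` is by region-counting).
LOCATED SENTENCE (tree currency, no side taken): as p432720 — S can coexist with the printed Statement only with volume match at EVERY label of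
`𝔽_l^⋇`; here the hypothesis under which this holds is the satisfiable per-element dichotomy, itself a CONSEQUENCE of volume characters, and the
mismatch is exhibited in Joshi's own frame at a setting where the Statement holds. [claim: Mochizuki2012, status: disputed]
[claim: Joshi2024ATS3, status: disputed]. Standard axioms only; no `sorry`.
-/

noncomputable section

open Set
namespace Summit.ABC.IUTFork.Joshi

open Thm311 Cor312 Cor312Vol

variable {T : ThetaIndex} {S : LatticeSituation T} {P : Cor312.Setting S.toSituation}
  {ρ : (∀ v : T.V, v ∈ T.Vbad → Set (S.L.StarPacket v)) → ∀ (j : T.Label) (vQ : T.VQ), Set (S.L.Packet j vQ)}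
  {qK : ∀ v : T.V, v ∈ T.Vbad → Set (S.L.StarPacket v)}

/-! ## 1. The per-element dichotomy, and its discharge from volume characters -/

/-- **E-cx's escape-horn binder implies the per-element form** «volume-preserving at the packet ∨ `¬HullDefined` there» (abc-iut-E-t43's
corrected form, p431585): a hull-destroying `Φ ∈ ⟨Ind1 ∪ Ind2⟩` makes `^{n,∘}𝒰_{j,v_ℚ}` undefined (`not_hullDefined_of_escapes`, p429682).
Every consumer of the X-07″ schema converts by this lemma. [folklore] -/
theorem preserving_or_not_hullDefined_of_escapeDichotomy {j : T.Label} {vQ : T.VQ}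
    (H1 : ∀ Φ ∈ Subgroup.closure (S.L.Ind1Family ∪ S.L.Ind2Family),
      (∀ A : Set (S.L.Packet j vQ), (S.D P.n).Adm j vQ A →
          (S.D P.n).Adm j vQ (Φ j vQ '' A) ∧ (S.D P.n).logvol j vQ (Φ j vQ '' A) = (S.D P.n).logvol j vQ A) ∨
      (∀ H ∈ (P.frame j vQ).Hul, ∃ k : ℕ, ¬ (Φ ^ k) j vQ '' P.thetaRegion3 j vQ ⊆ H)) :
    ∀ Φ ∈ Subgroup.closure (S.L.Ind1Family ∪ S.L.Ind2Family),
      (∀ A : Set (S.L.Packet j vQ), (S.D P.n).Adm j vQ A →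
          (S.D P.n).Adm j vQ (Φ j vQ '' A) ∧ (S.D P.n).logvol j vQ (Φ j vQ '' A) = (S.D P.n).logvol j vQ A) ∨
      ¬ P.HullDefined j vQ := fun Φ hΦ => by
  rcases H1 Φ hΦ with hv | hd
  · exact Or.inl hv
  · refine Or.inr (not_hullDefined_of_escapes fun H hH => ?_)
    obtain ⟨k, hk⟩ := hd H hH
    exact ⟨_, ⟨Φ ^ k, (Setting.indGroup S.toSituation).pow_mem hΦ k, rfl⟩, hk⟩

/-- **Identity form of S ⟹ volume match or hull blow-up, at each packet — per-element binder** (p432720's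
`exists_logvol_eq_or_not_hullDefined_of_pilotKummerCompatRegion` with the satisfiable binder): admissible Θ-Kummer datum regions at `(j, v_ℚ)`
and, for every `Φ ∈ ⟨Ind1 ∪ Ind2⟩`, «`Φ` volume-preserving on admissible regions there ∨ `¬HullDefined j v_ℚ`»; no pins, no `LogvolMono`,
no volume-invariance hypothesis. [folklore] -/
theorem exists_logvol_eq_or_not_hullDefined_of_pilotKummerCompatRegion' {j : T.Label} {vQ : T.VQ}
    (hΘ : ∀ m : ℤ, (S.D P.n).Adm j vQ (ρ ((S.col P.n).frobΨ m) j vQ))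
    (H1 : ∀ Φ ∈ Subgroup.closure (S.L.Ind1Family ∪ S.L.Ind2Family),
      (∀ A : Set (S.L.Packet j vQ), (S.D P.n).Adm j vQ A →
          (S.D P.n).Adm j vQ (Φ j vQ '' A) ∧ (S.D P.n).logvol j vQ (Φ j vQ '' A) = (S.D P.n).logvol j vQ A) ∨
      ¬ P.HullDefined j vQ)
    (h : PilotKummerCompatRegion S P ρ qK) :
    (∃ m : ℤ, (S.D P.n).logvol j vQ (ρ qK j vQ) = (S.D P.n).logvol j vQ (ρ ((S.col P.n).frobΨ m) j vQ)) ∨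
      ¬ P.HullDefined j vQ := by
  obtain ⟨Φ, hΦ, m, hm⟩ := h j vQ
  rcases H1 Φ hΦ with hv | hd
  · refine Or.inl ⟨m, ?_⟩
    rw [hm]
    exact (hv _ (hΘ m)).2
  · exact Or.inr hd

/-- **S ∧ volume mismatch at a label of `𝔽_l^⋇` ⟹ ¬Statement ∧ ¬BridgeHyps — per-element binder** (p432720's
`not_statement_of_pilotKummerIndRelated_of_ne` with the satisfiable binder), under Thm 3.11 (ii)(b) for column `n`, (hρ) and admissible
Θ-Kummer datum regions at that packet; the mismatch may be in either direction. [claim: Mochizuki2012, status: disputed] -/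
theorem not_statement_of_pilotKummerIndRelated_of_ne' (hKumB : (S.col P.n).KummerB (S.D P.n))
    (hρ : ∀ Φ ∈ Subgroup.closure (S.L.Ind1Family ∪ S.L.Ind2Family),
      ∀ (Ψ : ∀ v : T.V, v ∈ T.Vbad → Set (S.L.StarPacket v)) (j : T.Label) (vQ : T.VQ),
        ρ (fun v hv => S.L.starAut Φ v '' Ψ v hv) j vQ = Φ j vQ '' ρ Ψ j vQ)
    {i : Fin T.lstar} {vQ : T.VQ}
    (hΘ : ∀ m : ℤ, (S.D P.n).Adm (Setting.labelSucc i) vQ (ρ ((S.col P.n).frobΨ m) (Setting.labelSucc i) vQ))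
    (hne : ∀ m : ℤ, (S.D P.n).logvol (Setting.labelSucc i) vQ (ρ ((S.col P.n).frobΨ m) (Setting.labelSucc i) vQ) ≠
      (S.D P.n).logvol (Setting.labelSucc i) vQ (ρ qK (Setting.labelSucc i) vQ))
    (H1 : ∀ Φ ∈ Subgroup.closure (S.L.Ind1Family ∪ S.L.Ind2Family),
      (∀ A : Set (S.L.Packet (Setting.labelSucc i) vQ), (S.D P.n).Adm _ vQ A →
          (S.D P.n).Adm _ vQ (Φ _ vQ '' A) ∧ (S.D P.n).logvol _ vQ (Φ _ vQ '' A) = (S.D P.n).logvol _ vQ A) ∨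
      ¬ P.HullDefined (Setting.labelSucc i) vQ)
    (hS : PilotKummerIndRelated S P ρ qK) : ¬ P.Statement ∧ ¬ BridgeHyps P := by
  rcases exists_logvol_eq_or_not_hullDefined_of_pilotKummerCompatRegion' hΘ H1
      ((pilotKummerCompatRegion_iff_pilotKummerIndRelated S P ρ qK hKumB hρ).2 hS) with ⟨m, hm⟩ | hnd
  · exact absurd hm.symm (hne m)
  · exact ⟨not_statement_of_not_hullDefined hnd, not_bridgeHyps_of_not_hullDefined hnd⟩

/-- **The dichotomy binder DISCHARGED by volume characters** (abc-iut-E-t43's `preserving_or_not_hullDefined_of_volumeCharacter`, p431585):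
if every (Ind1)/(Ind2) GENERATOR transports admissibility both ways and shifts log-volume by a constant `c Φ` on admissible regions of the packet
`(j, v_ℚ)`, log-volume is monotone on admissible regions there, the Θ-Kummer datum regions are admissible and one of them lies in `Θ3`, then the
identity form of S gives volume match at `(j, v_ℚ)` OR `¬HullDefined j v_ℚ` — with NO dichotomy hypothesis left. [claim: Mochizuki2012, status: disputed] -/
theorem exists_logvol_eq_or_not_hullDefined_of_character {j : T.Label} {vQ : T.VQ} (c : S.L.PacketAut → ℝ)
    (hAdm : ∀ Φ ∈ S.L.Ind1Family ∪ S.L.Ind2Family, ∀ A : Set (S.L.Packet j vQ),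
      (S.D P.n).Adm j vQ A ↔ (S.D P.n).Adm j vQ (Φ j vQ '' A))
    (hvol : ∀ Φ ∈ S.L.Ind1Family ∪ S.L.Ind2Family, ∀ A : Set (S.L.Packet j vQ),
      (S.D P.n).Adm j vQ A → (S.D P.n).logvol j vQ (Φ j vQ '' A) = (S.D P.n).logvol j vQ A + c Φ)
    (hmono : ∀ A B : Set (S.L.Packet j vQ), (S.D P.n).Adm j vQ A → (S.D P.n).Adm j vQ B → A ⊆ B →
      (S.D P.n).logvol j vQ A ≤ (S.D P.n).logvol j vQ B)
    (hΘ : ∀ m : ℤ, (S.D P.n).Adm j vQ (ρ ((S.col P.n).frobΨ m) j vQ))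
    (hΘ3 : ∃ m : ℤ, ρ ((S.col P.n).frobΨ m) j vQ ⊆ P.thetaRegion3 j vQ)
    (h : PilotKummerCompatRegion S P ρ qK) :
    (∃ m : ℤ, (S.D P.n).logvol j vQ (ρ qK j vQ) = (S.D P.n).logvol j vQ (ρ ((S.col P.n).frobΨ m) j vQ)) ∨
      ¬ P.HullDefined j vQ :=
  let ⟨m₀, hm₀⟩ := hΘ3
  exists_logvol_eq_or_not_hullDefined_of_pilotKummerCompatRegion' hΘ
    (fun _ hΦ => preserving_or_not_hullDefined_of_volumeCharacter P c hAdm hvol hmono (hΘ m₀) hm₀ hΦ) h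

/-- **S ∧ volume mismatch at a label of `𝔽_l^⋇` ⟹ ¬Statement ∧ ¬BridgeHyps, from volume characters** — the binder-free form: Thm 3.11
(ii)(b) for column `n`, (hρ), generators with volume characters at the packet, packet-monotonicity, admissible Θ-Kummer datum regions one of
which lies in `Θ3`, and log-volumes all DIFFERENT from the q-datum region's (either direction). [claim: Mochizuki2012, status: disputed] -/
theorem not_statement_of_pilotKummerIndRelated_of_ne_of_character (hKumB : (S.col P.n).KummerB (S.D P.n))
    (hρ : ∀ Φ ∈ Subgroup.closure (S.L.Ind1Family ∪ S.L.Ind2Family),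
      ∀ (Ψ : ∀ v : T.V, v ∈ T.Vbad → Set (S.L.StarPacket v)) (j : T.Label) (vQ : T.VQ),
        ρ (fun v hv => S.L.starAut Φ v '' Ψ v hv) j vQ = Φ j vQ '' ρ Ψ j vQ)
    {i : Fin T.lstar} {vQ : T.VQ} (c : S.L.PacketAut → ℝ)
    (hAdm : ∀ Φ ∈ S.L.Ind1Family ∪ S.L.Ind2Family, ∀ A : Set (S.L.Packet (Setting.labelSucc i) vQ),
      (S.D P.n).Adm _ vQ A ↔ (S.D P.n).Adm _ vQ (Φ _ vQ '' A))
    (hvol : ∀ Φ ∈ S.L.Ind1Family ∪ S.L.Ind2Family, ∀ A : Set (S.L.Packet (Setting.labelSucc i) vQ),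
      (S.D P.n).Adm _ vQ A → (S.D P.n).logvol _ vQ (Φ _ vQ '' A) = (S.D P.n).logvol _ vQ A + c Φ)
    (hmono : ∀ A B : Set (S.L.Packet (Setting.labelSucc i) vQ), (S.D P.n).Adm _ vQ A → (S.D P.n).Adm _ vQ B → A ⊆ B →
      (S.D P.n).logvol _ vQ A ≤ (S.D P.n).logvol _ vQ B)
    (hΘ : ∀ m : ℤ, (S.D P.n).Adm (Setting.labelSucc i) vQ (ρ ((S.col P.n).frobΨ m) (Setting.labelSucc i) vQ))
    (hΘ3 : ∃ m : ℤ, ρ ((S.col P.n).frobΨ m) (Setting.labelSucc i) vQ ⊆ P.thetaRegion3 (Setting.labelSucc i) vQ)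
    (hne : ∀ m : ℤ, (S.D P.n).logvol (Setting.labelSucc i) vQ (ρ ((S.col P.n).frobΨ m) (Setting.labelSucc i) vQ) ≠
      (S.D P.n).logvol (Setting.labelSucc i) vQ (ρ qK (Setting.labelSucc i) vQ))
    (hS : PilotKummerIndRelated S P ρ qK) : ¬ P.Statement ∧ ¬ BridgeHyps P := by
  rcases exists_logvol_eq_or_not_hullDefined_of_character c hAdm hvol hmono hΘ hΘ3
      ((pilotKummerCompatRegion_iff_pilotKummerIndRelated S P ρ qK hKumB hρ).2 hS) with ⟨m, hm⟩ | hnd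
  · exact absurd hm.symm (hne m)
  · exact ⟨not_statement_of_not_hullDefined hnd, not_bridgeHyps_of_not_hullDefined hnd⟩

/-- Under the Θ-pin the `Θ3` side condition is automatic: every Θ-Kummer datum region IS a column Θ-region `⊆ Θ3`. [folklore] -/
theorem exists_subset_thetaRegion3_of_thetaPinned (hΘpin : ThetaPinned S P ρ) (j : T.Label) (vQ : T.VQ) :
    ∃ m : ℤ, ρ ((S.col P.n).frobΨ m) j vQ ⊆ P.thetaRegion3 j vQ :=
  ⟨0, by rw [← hΘpin.2 0 j vQ]; exact Set.subset_iUnion (fun m => P.thetaRegion m j vQ) 0⟩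

/-! ## 2. Y₁-form (the X-01 dictionary sentence): Joshi's change of untilt read as an indeterminacy -/

/-- **Y₁ + Joshi's identity side ⟹ volume match or hull blow-up, packet by packet.** If the label-wise change of untilt `u_j` lies in
`⟨Ind1 ∪ Ind2⟩` (Y₁ = `UntiltChangeIsInd`, [J-III] §8.11.1 p.91 l.27–40 read as (Ind2)) and carries a Θ-Kummer datum region ONTO the
q-datum region (`UntiltChangeCarriesQ`), then under the per-element dichotomy at `(j, v_ℚ)` the volumes match there or `^{n,∘}𝒰_{j,v_ℚ}` is
undefined — no Thm 3.11 clause, no (hρ), no pins. [claim: Joshi2024ATS3, status: disputed] -/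
theorem exists_logvol_eq_or_not_hullDefined_of_untiltChange {u : T.Label → S.L.PacketAut} (hY : UntiltChangeIsInd S u)
    (hJ : UntiltChangeCarriesQ S P ρ qK u) {j : T.Label} {vQ : T.VQ}
    (hΘ : ∀ m : ℤ, (S.D P.n).Adm j vQ (ρ ((S.col P.n).frobΨ m) j vQ))
    (H1 : ∀ Φ ∈ Subgroup.closure (S.L.Ind1Family ∪ S.L.Ind2Family),
      (∀ A : Set (S.L.Packet j vQ), (S.D P.n).Adm j vQ A →
          (S.D P.n).Adm j vQ (Φ j vQ '' A) ∧ (S.D P.n).logvol j vQ (Φ j vQ '' A) = (S.D P.n).logvol j vQ A) ∨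
      ¬ P.HullDefined j vQ) :
    (∃ m : ℤ, (S.D P.n).logvol j vQ (ρ qK j vQ) = (S.D P.n).logvol j vQ (ρ ((S.col P.n).frobΨ m) j vQ)) ∨
      ¬ P.HullDefined j vQ :=
  exists_logvol_eq_or_not_hullDefined_of_pilotKummerCompatRegion' hΘ H1 (pilotKummerCompatRegion_of_untiltChange hY hJ)

/-- **Hence the X-01 programme (FILLS-MODULO-Y₁) can deliver S only together with volume match, or where the Statement FAILS as typed**:
Y₁ ∧ `UntiltChangeCarriesQ u` ∧ (volume mismatch at one label of `𝔽_l^⋇`) ⟹ ¬Statement ∧ ¬BridgeHyps, under the per-element dichotomy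
there. In Joshi's normalisation ((9.9.4): exponent `j²/ℓ*²` against the q-datum's `1`) the mismatch is present at every label `j < ℓ*` as
soon as `ℓ* ≥ 2` (§3). [claim: Joshi2024ATS3, status: disputed] -/
theorem not_statement_of_untiltChange_of_ne {u : T.Label → S.L.PacketAut} (hY : UntiltChangeIsInd S u)
    (hJ : UntiltChangeCarriesQ S P ρ qK u) {i : Fin T.lstar} {vQ : T.VQ}
    (hΘ : ∀ m : ℤ, (S.D P.n).Adm (Setting.labelSucc i) vQ (ρ ((S.col P.n).frobΨ m) (Setting.labelSucc i) vQ))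
    (hne : ∀ m : ℤ, (S.D P.n).logvol (Setting.labelSucc i) vQ (ρ ((S.col P.n).frobΨ m) (Setting.labelSucc i) vQ) ≠
      (S.D P.n).logvol (Setting.labelSucc i) vQ (ρ qK (Setting.labelSucc i) vQ))
    (H1 : ∀ Φ ∈ Subgroup.closure (S.L.Ind1Family ∪ S.L.Ind2Family),
      (∀ A : Set (S.L.Packet (Setting.labelSucc i) vQ), (S.D P.n).Adm _ vQ A →
          (S.D P.n).Adm _ vQ (Φ _ vQ '' A) ∧ (S.D P.n).logvol _ vQ (Φ _ vQ '' A) = (S.D P.n).logvol _ vQ A) ∨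
      ¬ P.HullDefined (Setting.labelSucc i) vQ) :
    ¬ P.Statement ∧ ¬ BridgeHyps P := by
  rcases exists_logvol_eq_or_not_hullDefined_of_untiltChange hY hJ hΘ H1 with ⟨m, hm⟩ | hnd
  · exact absurd hm.symm (hne m)
  · exact ⟨not_statement_of_not_hullDefined hnd, not_bridgeHyps_of_not_hullDefined hnd⟩

/-! ## 3. Joshi's frame: abc-iut-E-t4's object-honest Joshi-normalised setting -/

section Models

open Cor312.Checks Cor312.IdentifiedNonVacuity PinnedWitness NaiveWitness GluedMonoids.Naive

variable (p : ℕ) [hp : Fact p.Prime]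

/-- **Joshi's normalisation** (abc-iut-E-t4's object-honest Joshi-normalised setting, p429514: q := `p^{ℓ*²}`, so the q-datum region is
`B_{ℓ*²} = B_4` at every label of `𝔽_l^⋇`, the Θ-Kummer datum regions are `B_{j²}`) — the datum regions MISMATCH at the label `j = 1 < ℓ*`
(`B_1` against `B_4`: Θ ABOVE q) … [folklore] -/
theorem honestJoshiSetting_logvol_ne (m : ℤ) :
    ((naiveFull p).toLatticeSituation.D (honestJoshiSetting p).n).logvol (Setting.labelSucc ⟨0, zero_lt_lstar⟩) ()
        (orbitRegion p (((naiveFull p).toLatticeSituation.col (honestJoshiSetting p).n).frobΨ m)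
          (Setting.labelSucc ⟨0, zero_lt_lstar⟩) ()) ≠
      ((naiveFull p).toLatticeSituation.D (honestJoshiSetting p).n).logvol (Setting.labelSucc ⟨0, zero_lt_lstar⟩) ()
        (orbitRegion p (honestQDatum p) (Setting.labelSucc ⟨0, zero_lt_lstar⟩) ()) := by
  rw [← (honest_thetaPinned p).2 m _ (), ← honest_qPinned p _ (), honest_thetaRegion,
    honest_qRegion_of_ne_zero p (Setting.labelSucc_ne_zero _)]
  show pVol p _ () (pBall p _ () (jsq _)) ≠ pVol p _ () (pBall p _ () 4)
  have h1 : jsq (Setting.labelSucc ⟨0, zero_lt_lstar⟩ : toyIndex.Label) = 1 := rfl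
  rw [h1, pVol_pBall, pVol_pBall]
  have := log_p_pos p
  push_cast
  intro h
  nlinarith

/-- … and MATCH at the top label `j = ℓ* = 2` (`B_4` on both sides): in Joshi's frame volume match holds EXACTLY at the top label — the
one label at which (9.9.4)'s exponent `j²/ℓ*²` equals `1`. [folklore] -/
theorem honestJoshiSetting_logvol_eq_top (m : ℤ) :
    ((naiveFull p).toLatticeSituation.D (honestJoshiSetting p).n).logvol (Setting.labelSucc ⟨1, one_lt_lstar⟩) ()
        (orbitRegion p (((naiveFull p).toLatticeSituation.col (honestJoshiSetting p).n).frobΨ m)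
          (Setting.labelSucc ⟨1, one_lt_lstar⟩) ()) =
      ((naiveFull p).toLatticeSituation.D (honestJoshiSetting p).n).logvol (Setting.labelSucc ⟨1, one_lt_lstar⟩) ()
        (orbitRegion p (honestQDatum p) (Setting.labelSucc ⟨1, one_lt_lstar⟩) ()) := by
  rw [← (honest_thetaPinned p).2 m _ (), ← honest_qPinned p _ (), honest_thetaRegion,
    honest_qRegion_of_ne_zero p (Setting.labelSucc_ne_zero _)]
  have h4 : jsq (Setting.labelSucc ⟨1, one_lt_lstar⟩ : toyIndex.Label) = 4 := rfl
  rw [h4]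

/-- **At E-t4's honest Joshi-normalised setting — where the printed Statement HOLDS (`honest_statement`, by volume transport) — S is refuted
BY THE VOLUME ROUTE**: Thm 3.11 (ii)(b) and Θ-admissibility are the model's own `naive_partII` / `honest_thetaRegionsAdm`, (hρ) its
`honest_thetaPinned`, the mismatch sits at `j = 1` (`honestJoshiSetting_logvol_ne`), and the dichotomy holds through its volume-preserving
horn (the sign group fixes every ball, `NaiveWitness.image_pBall_of_mem_closure`; admissible regions are the balls). A second proof of
E-t4's `honest_not_pilotKummerIndRelated` (which counts regions), through p432720's `not_statement_of_pilotKummerIndRelated_of_ne`.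
[claim: Joshi2024ATS3, status: disputed] -/
theorem honestJoshiSetting_not_pilotKummerIndRelated_by_volume :
    ¬ PilotKummerIndRelated (naiveFull p).toLatticeSituation (honestJoshiSetting p) (orbitRegion p) (honestQDatum p) := fun hS =>
  have hΘ : ∀ m : ℤ, ((naiveFull p).toLatticeSituation.D (honestJoshiSetting p).n).Adm (Setting.labelSucc ⟨0, zero_lt_lstar⟩) ()
      (orbitRegion p (((naiveFull p).toLatticeSituation.col (honestJoshiSetting p).n).frobΨ m)
        (Setting.labelSucc ⟨0, zero_lt_lstar⟩) ()) := fun m => by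
    rw [← (honest_thetaPinned p).2 m _ ()]
    exact honest_thetaRegionsAdm p m _ ()
  (not_statement_of_pilotKummerIndRelated_of_ne (naive_partII p (honestJoshiSetting p).n).2.1 (honest_thetaPinned p).1 hΘ
    (honestJoshiSetting_logvol_ne p) (fun Φ hΦ => Or.inl fun A hA => by
      obtain ⟨k, rfl⟩ := hA
      rw [image_pBall_of_mem_closure p hΦ]
      exact ⟨⟨k, rfl⟩, rfl⟩) hS).1 (honest_statement p)

end Models

end Summit.ABC.IUTFork.Joshi

end
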